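import Summits.QuantumFields.YangMills.Theorems.BalabanUVNodesN07DirectMethod

/-!
# BalabanUVNodes ∕ N07 ([Balaban1985Variational] (2), (5) p. 278; [Balaban1987RG1] (0.4) p. 253) — LOCAL CONTINUITY OF THE AVERAGING OF RECORD:
# the coarse bond variable `Ū^{j+1}(c)` is a continuous function of the fine configuration at every `U₀` whose `j`-fold average has its (0.4) loop
# variables AT `c` inside the guard, provided the finitely many fine bond variables `Ū^j(b)`, `b` in the two blocks of `c`, are continuous at `U₀` —
# the geometry-free brick from which the direct method extends to classes with HOLES (small fields on regions only)

Track A of `YM-PLAN.md` (cell `pub-ymgap`, HUMAN RULING D-0062), DAG node **N07**; seat `pub-ymgap-dag-n07-e` (generation 5; module 16, companion of module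
11a `…N07DirectMethod` (p487790), whose §2 proves continuity of `Ū^k` as a WHOLE MAP at configurations small EVERYWHERE — the no-holes case; this module is
the per-bond, LOCAL form asked for by the multi-scale classes of record with holes (def-R's `regMSOfRecord`, [Balaban1985Variational]'s general `{Ω_j}`):
`--supports stmt-QuantumFields-19903 --as helper`).  THEOREMS ONLY (0 `def`, 0 `sorry`); nothing imported is modified.

CONTENT (`SU(N)`, any torus `P`, level `j`; the averaging of record `blockAvg expMeanLogSU` = `Node00.avOfRecord F N K j` by `rfl`):
* `continuousAt_avgFun_apply_of_small` — ONE coarse bond: `U ↦ (avgFun expMeanLogSU U) c` is continuous at every `U₀` with `Small expMeanLogSU U₀ c`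
  (the (0.4) loop variables AT `c` inside the guard: there the map is `E(loop variables)·U(c)` on the open guard, K0c's `isOpen_small` ∕
  `continuousOn_avg_loopHol`); no condition away from `c`.
* ★ `continuousAt_avgFun_comp_apply_of_small_of_local` — LOCALITY: for ANY map `Φ : X → SU(N)^{bonds_j}` from a topological space and `x₀ ∈ X`, if
  `Small (Φ x₀) c` and the finitely many coordinates `x ↦ Φ x b` for the fine bonds `b` of the two blocks of `c` (`blockOf b₋ ∈ {c₋, c₊}`, the tree's
  `Averaging.local_dep` window, standing range `j + 1 ≤ m + K`) are continuous at `x₀`, then `x ↦ (avgFun expMeanLogSU (Φ x)) c` is continuous at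
  `x₀` — by splicing `Φ x` with `Φ x₀` off the window (`BlockAveraging.avgFun_local`).
* ★ `continuousAt_iter_succ_apply_of_small_of_local` — the instance `Φ := Ū^j`: `U ↦ Ū^{j+1}(c)` is continuous at `U₀` as soon as `Small (Ū₀^j) c`
  and `U ↦ Ū^j(b)` is continuous at `U₀` for the fine bonds `b` of the two blocks of `c`; iterating this along the block tower under a bond is the
  holes-version of module 11a §2 (the smallness then comes from n21-c's LOCAL Proposition 2 on the regions — not composed here).
* `continuousAt_iter_zero_apply` (level `0`: the identity); `continuousAt_iter_one_apply_of_small` (level `1`: `Small U₀ c` alone); `continuousAt_iter_two_apply_of_small`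
  (level `2`, the first genuinely local step: smallness of `Ū₀^1` at `c` and of `U₀` at the level-`1` bonds of `c`'s window — the tower under `c` only).
* `isClosed_inter_agreeOn_of_continuousOn`, ★ `exists_isMinimizer_of_isClosed_of_continuousOn` — module 13's direct method for (2.12) in GEOMETRY-FREE form:
  the no-holes inclusion `reg ⊆ bgReg` is replaced by exactly what it was used for, continuity ON `reg` of the constrained bond variables `U ↦ Ū^j(b)`,
  `b ∈ bonds(Γ_j)` — which classes with holes get bond by bond from the brick.

HONEST FRAMING.  Kernel facts about the tree's own averaging; nothing of Bałaban's asserted; no class, region or proviso of record is touched; N07 ∕ K0′ NOT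
discharged; COUNT-NEUTRAL (5∕27 unmoved); one finite four-torus programme at fixed `ε = L^{−K}` — NOT the continuum limit, NOT ℝ⁴, NOT infinite volume, NOT
OS, NOT a mass gap, NOT Clay.  No `instance`, no notation, 0 kit.
-/

noncomputable section

namespace Summit.QuantumFields.YangMills.BalabanUVNodes.N07AveragingLocalContinuity

open Set Filter Topology
open Literature.MathematicalPhysics.QuantumFieldTheory.Balaban1983to89
open Literature.MathematicalPhysics.QuantumFieldTheory.Balaban1983to89.T4Continuum (T4Family)
open Literature.MathematicalPhysics.QuantumFieldTheory.Balaban1983to89.Node00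
open Literature.MathematicalPhysics.QuantumFieldTheory.Balaban1983to89.BlockAveraging (blockAvg avgFun corr loopHol Small continuous_axialAvg
  avgFun_local)
open Literature.MathematicalPhysics.QuantumFieldTheory.Balaban1983to89.ExpMeanLog (expMeanLogSU deltaSU)
open scoped Matrix.Norms.L2Operator

variable {N : ℕ} [NeZero N] {P : Params} {j : ℕ}

/-- **ONE COARSE BOND: the (0.4) average `(avgFun ℰ U) c` is continuous in `U` at every `U₀` whose loop variables AT `c` lie inside the guard** — on
K0c's open guard `{Small U c}` the map is `E(loop variables at c) · U(c)`, `E` continuous there; nothing is asked at other bonds.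
[cite: Balaban1987RG1, (0.4) p.253] -/
theorem continuousAt_avgFun_apply_of_small {U₀ : GaugeField P j (SU N)} (c : PBond P (j + 1))
    (h : Small (expMeanLogSU (n := Fin N)) U₀ c) :
    ContinuousAt (fun U : GaugeField P j (SU N) => avgFun (expMeanLogSU (n := Fin N)) U c) U₀ := by
  have hax : Continuous fun U : GaugeField P j (SU N) => AveragingRT.axialAvg U c := (continuous_apply c).comp continuous_axialAvg
  have hcorr : ContinuousOn (fun U : GaugeField P j (SU N) => corr (expMeanLogSU (n := Fin N)) U c)
      {U | Small (expMeanLogSU (n := Fin N)) U c} := by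
    refine (continuousOn_avg_loopHol c).congr fun U hU => ?_
    have hU' : Small (expMeanLogSU (n := Fin N)) U c := hU
    show corr _ U c = _
    unfold corr
    rw [if_pos hU']
  have hA : ContinuousOn (fun U : GaugeField P j (SU N) => corr (expMeanLogSU (n := Fin N)) U c * AveragingRT.axialAvg U c)
      {U | Small (expMeanLogSU (n := Fin N)) U c} := hcorr.mul hax.continuousOn
  exact hA.continuousAt ((isOpen_small (N := N) c).mem_nhds h)

/-- ★ **LOCALITY ⇒ LOCAL CONTINUITY.**  Let `Φ : X → SU(N)^{bonds_j}` be any map from a topological space, `x₀ ∈ X`, `c` a coarse bond, standing range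
`j + 1 ≤ m + K`.  If the loop variables of `Φ x₀` AT `c` lie inside the guard and each fine bond variable `x ↦ Φ x b` for `b` in the window of `c`
(`blockOf b₋ = c₋` or `= c₊` — the only bonds `(avgFun ℰ ·) c` reads, `BlockAveraging.avgFun_local`) is continuous at `x₀`, then `x ↦ (avgFun ℰ (Φ x)) c` is
continuous at `x₀`.  Proof: splice `Φ x` with the frozen `Φ x₀` off the window; the spliced map is continuous at `x₀` into the product and has the same
average at `c`. [cite: Balaban1987RG1, (0.4) p.253; Balaban1985Averaging, p.19 (locality)] -/
theorem continuousAt_avgFun_comp_apply_of_small_of_local {X : Type*} [TopologicalSpace X] (hj : j + 1 ≤ P.m + P.K)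
    {Φ : X → GaugeField P j (SU N)} {x₀ : X} (c : PBond P (j + 1)) (hsmall : Small (expMeanLogSU (n := Fin N)) (Φ x₀) c)
    (hloc : ∀ b : PBond P j, (blockOf b.src = c.src ∨ blockOf b.src = c.tgt) → ContinuousAt (fun x => Φ x b) x₀) :
    ContinuousAt (fun x => avgFun (expMeanLogSU (n := Fin N)) (Φ x) c) x₀ := by
  classical
  -- the splice: `Φ x` on the window of `c`, the frozen `Φ x₀` elsewhere
  let Ψ : X → GaugeField P j (SU N) := fun x b =>
    if blockOf b.src = c.src ∨ blockOf b.src = c.tgt then Φ x b else Φ x₀ b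
  have hΨ0 : Ψ x₀ = Φ x₀ := by
    funext b
    show (if blockOf b.src = c.src ∨ blockOf b.src = c.tgt then Φ x₀ b else Φ x₀ b) = Φ x₀ b
    split_ifs <;> rfl
  have hΨcont : ContinuousAt Ψ x₀ := by
    refine continuousAt_pi.2 fun b => ?_
    by_cases hb : blockOf b.src = c.src ∨ blockOf b.src = c.tgt
    · have : (fun x => Ψ x b) = fun x => Φ x b := funext fun x => if_pos hb
      rw [this]
      exact hloc b hb
    · have : (fun x => Ψ x b) = fun _ => Φ x₀ b := funext fun x => if_neg hb
      rw [this]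
      exact continuousAt_const
  have heq : (fun x => avgFun (expMeanLogSU (n := Fin N)) (Φ x) c) = fun x => avgFun (expMeanLogSU (n := Fin N)) (Ψ x) c := by
    funext x
    exact avgFun_local _ hj (Φ x) (Ψ x) c fun b hb => (if_pos hb).symm
  rw [heq]
  have hg : ContinuousAt (fun U : GaugeField P j (SU N) => avgFun (expMeanLogSU (n := Fin N)) U c) (Ψ x₀) := by
    rw [hΨ0]
    exact continuousAt_avgFun_apply_of_small c hsmall
  exact hg.comp hΨcont

variable {F : T4Family}

/-- Level `0` of the tower: `Ū^0 = U`, every coordinate continuous. [cite: Balaban1987RG1, (0.11) p.253 (bookkeeping)] -/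
theorem continuousAt_iter_zero_apply (K : ℕ) (U₀ : GaugeField (F.P K) 0 (SU N)) (b : PBond (F.P K) 0) :
    ContinuousAt (fun U : GaugeField (F.P K) 0 (SU N) => Averaging.iter (avOfRecord F N K) 0 U b) U₀ :=
  (continuous_apply b).continuousAt

/-- ★ **ONE STEP UP THE BLOCK TOWER FOR THE AVERAGING OF RECORD**: `U ↦ Ū^{j+1}(c)` (`Averaging.iter (avOfRecord F N K) (j+1) · c`) is continuous at `U₀`
as soon as the loop variables of `Ū₀^j` AT `c` lie inside the guard and `U ↦ Ū^j(b)` is continuous at `U₀` for every fine bond `b` in the window of `c`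
(standing range `j + 1 ≤ m + K`).  Iterated down the tower under a bond, with the smallness supplied on the regions by n21-c's LOCAL Proposition 2, this is
the holes-version of module 11a §2. [cite: Balaban1987RG1, (0.4), (0.11) p.253; Balaban1985Variational, (2) p.278 (classes with holes `{Ω_j}`)] -/
theorem continuousAt_iter_succ_apply_of_small_of_local (K j : ℕ) (hj : j + 1 ≤ (F.P K).m + (F.P K).K) {U₀ : GaugeField (F.P K) 0 (SU N)}
    (c : PBond (F.P K) (j + 1)) (hsmall : Small (expMeanLogSU (n := Fin N)) (Averaging.iter (avOfRecord F N K) j U₀) c)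
    (hloc : ∀ b : PBond (F.P K) j, (blockOf b.src = c.src ∨ blockOf b.src = c.tgt) →
      ContinuousAt (fun U : GaugeField (F.P K) 0 (SU N) => Averaging.iter (avOfRecord F N K) j U b) U₀) :
    ContinuousAt (fun U : GaugeField (F.P K) 0 (SU N) => Averaging.iter (avOfRecord F N K) (j + 1) U c) U₀ :=
  continuousAt_avgFun_comp_apply_of_small_of_local hj c hsmall hloc

/-- **LEVEL 1**: `U ↦ Ū^1(c)` is continuous at every `U₀` whose loop variables AT `c` lie inside the guard — the window coordinates at level `0` are the
bond variables themselves (`1 ≤ m + K`). [cite: Balaban1987RG1, (0.4) p.253] -/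
theorem continuousAt_iter_one_apply_of_small (K : ℕ) (hK : 1 ≤ (F.P K).m + (F.P K).K) {U₀ : GaugeField (F.P K) 0 (SU N)}
    (c : PBond (F.P K) 1) (hsmall : Small (expMeanLogSU (n := Fin N)) U₀ c) :
    ContinuousAt (fun U : GaugeField (F.P K) 0 (SU N) => Averaging.iter (avOfRecord F N K) 1 U c) U₀ :=
  continuousAt_iter_succ_apply_of_small_of_local K 0 hK c hsmall fun b _ => continuousAt_iter_zero_apply K U₀ b

/-- **LEVEL 2** (the first genuinely local step): `U ↦ Ū^2(c)` is continuous at `U₀` if the loop variables of `Ū₀^1` AT `c` and those of `U₀` AT every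
level-`1` bond `c′` in the window of `c` lie inside the guard (`2 ≤ m + K`) — smallness on the tower under `c` only. [cite: Balaban1987RG1, (0.4), (0.11) p.253] -/
theorem continuousAt_iter_two_apply_of_small (K : ℕ) (hK : 2 ≤ (F.P K).m + (F.P K).K) {U₀ : GaugeField (F.P K) 0 (SU N)}
    (c : PBond (F.P K) 2) (hsmall : Small (expMeanLogSU (n := Fin N)) (Averaging.iter (avOfRecord F N K) 1 U₀) c)
    (hwin : ∀ c' : PBond (F.P K) 1, (blockOf c'.src = c.src ∨ blockOf c'.src = c.tgt) → Small (expMeanLogSU (n := Fin N)) U₀ c') :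
    ContinuousAt (fun U : GaugeField (F.P K) 0 (SU N) => Averaging.iter (avOfRecord F N K) 2 U c) U₀ :=
  continuousAt_iter_succ_apply_of_small_of_local K 1 hK c hsmall fun c' hc' =>
    continuousAt_iter_one_apply_of_small K (le_trans (by norm_num) hK) c' (hwin c' hc')

/-- **The loop-variable hypothesis from a LOCAL plaquette bound is NOT composed here** (it needs the local Stokes letter on the window of `c`); what IS
immediate: if ALL plaquette variables of `Ū₀^j` are within `a` of `1` with `(((d+2)L)²/4)·a < δ_N`, the guard holds at every `c`
(`LatticeWordStokes.small_of_plaqSmall`) — the global form module 11a uses. [cite: Balaban1987RG1, (0.4) p.253] -/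
theorem small_iter_of_plaqSmall (K j : ℕ) {a : ℝ} (ha : 0 ≤ a) {U₀ : GaugeField (F.P K) 0 (SU N)}
    (hU : PlaqSmall a (Averaging.iter (avOfRecord F N K) j U₀))
    (ht : (((((F.P K).d + 2) * (F.P K).L : ℕ) : ℝ) ^ 2 / 4) * a < deltaSU (Fin N)) (c : PBond (F.P K) (j + 1)) :
    Small (expMeanLogSU (n := Fin N)) (Averaging.iter (avOfRecord F N K) j U₀) c :=
  LatticeWordStokes.small_of_plaqSmall _ ha hU ht c

/-! ## The direct method for (2.12) with the continuity supplied PER CONSTRAINT BOND (the geometry-free form of module 13) -/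

section DetSetLocal

open Literature.MathematicalPhysics.QuantumFieldTheory.Balaban1983to89.B15DeterminingSets (DetSet MSField AgreeOn avgFamily bondsOf IsMinimizer)
open Summit.QuantumFields.YangMills.BalabanUVNodes.N07DirectMethod (isCompact_of_isClosed_cfg continuous_wilsonAction4)

/-- **THE (2.10) CONSTRAINT SET IS CLOSED IN ANY CLOSED CLASS ON WHICH THE CONSTRAINED BOND VARIABLES ARE CONTINUOUS**: for a closed `reg`, a determining set
`𝔹` supported on scales `≤ J`, and data `W`, if every constrained bond variable `U ↦ Ū^j(b)`, `b ∈ bonds(Γ_j)`, `j ≤ J`, is continuous ON `reg` (for classes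
with holes: from the brick above, down the tower under `b`), then `{U ∈ reg : M_𝔹(U) = W}` is closed — module 13's `isClosed_inter_agreeOn` with the
no-holes inclusion `reg ⊆ bgReg` replaced by exactly the continuity it was used for. [cite: Balaban1988Convergent, (2.10)–(2.11) p.256] -/
theorem isClosed_inter_agreeOn_of_continuousOn (K J : ℕ) {reg : Set (GaugeField (F.P K) 0 (SU N))} (hreg : IsClosed reg)
    (𝔹 : DetSet (F.P K)) (h𝔹 : ∀ j, J < j → 𝔹 j = ∅)
    (hcont : ∀ j : ℕ, j ≤ J → ∀ b ∈ bondsOf (𝔹 j), ContinuousOn (fun U : GaugeField (F.P K) 0 (SU N) => Averaging.iter (avOfRecord F N K) j U b) reg)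
    (W : MSField (F.P K) (SU N)) :
    IsClosed (reg ∩ {U | AgreeOn 𝔹 (avgFamily (avOfRecord F N K) U) W}) := by
  have h1 : ∀ (j : Fin (J + 1)) (b : PBond (F.P K) j), b ∈ bondsOf (𝔹 j) →
      IsClosed (reg ∩ (fun U : GaugeField (F.P K) 0 (SU N) => Averaging.iter (avOfRecord F N K) j U b) ⁻¹' {W j b}) :=
    fun j b hb => (hcont j (Nat.lt_succ_iff.mp j.2) b hb).preimage_isClosed_of_isClosed hreg isClosed_singleton
  have hS : reg ∩ {U | AgreeOn 𝔹 (avgFamily (avOfRecord F N K) U) W} =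
      reg ∩ ⋂ j : Fin (J + 1), ⋂ b ∈ bondsOf (𝔹 j),
        (reg ∩ (fun U : GaugeField (F.P K) 0 (SU N) => Averaging.iter (avOfRecord F N K) j U b) ⁻¹' {W j b}) := by
    ext U
    simp only [mem_inter_iff, mem_setOf_eq, mem_iInter, mem_preimage, mem_singleton_iff,
      agreeOn_avgFamily_iff_fin (avOfRecord F N K) h𝔹]
    exact ⟨fun ⟨hU, h⟩ => ⟨hU, fun j b hb => ⟨hU, h j b hb⟩⟩, fun ⟨hU, h⟩ => ⟨hU, fun j b hb => (h j b hb).2⟩⟩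
  rw [hS]
  exact hreg.inter (isClosed_iInter fun j => isClosed_biInter fun b hb => h1 j b hb)

/-- ★ **THE DIRECT METHOD FOR (2.12), GEOMETRY-FREE**: a closed class, a determining set supported on scales `≤ J`, the constrained bond variables continuous ON
the class, and a non-empty fibre ⇒ `∃ U₀, IsMinimizer (avOfRecord F N K) reg 𝔹 W U₀` (def-R's exact predicate).  With holes the continuity hypothesis is fed
bond by bond from `continuousAt_iter_succ_apply_of_small_of_local`. [cite: Balaban1988Convergent, (2.12) p.256; Balaban1985Variational, Thm 1 (8) p.279] -/
theorem exists_isMinimizer_of_isClosed_of_continuousOn (K J : ℕ) {reg : Set (GaugeField (F.P K) 0 (SU N))} (hreg : IsClosed reg)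
    (𝔹 : DetSet (F.P K)) (h𝔹 : ∀ j, J < j → 𝔹 j = ∅)
    (hcont : ∀ j : ℕ, j ≤ J → ∀ b ∈ bondsOf (𝔹 j), ContinuousOn (fun U : GaugeField (F.P K) 0 (SU N) => Averaging.iter (avOfRecord F N K) j U b) reg)
    {W : MSField (F.P K) (SU N)} (hne : ∃ U ∈ reg, AgreeOn 𝔹 (avgFamily (avOfRecord F N K) U) W) :
    ∃ U₀ : GaugeField (F.P K) 0 (SU N), IsMinimizer (avOfRecord F N K) reg 𝔹 W U₀ := by
  have hSc := isClosed_inter_agreeOn_of_continuousOn K J hreg 𝔹 h𝔹 hcont W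
  have hSne : (reg ∩ {U | AgreeOn 𝔹 (avgFamily (avOfRecord F N K) U) W}).Nonempty := by
    obtain ⟨U, hU, hA⟩ := hne
    exact ⟨U, hU, hA⟩
  obtain ⟨U₀, hU₀S, hmin⟩ := (isCompact_of_isClosed_cfg hSc).exists_isMinOn hSne continuous_wilsonAction4.continuousOn
  exact ⟨U₀, hU₀S.1, hU₀S.2, fun U hU hA => (isMinOn_iff.1 hmin) U ⟨hU, hA⟩⟩

end DetSetLocal

end Summit.QuantumFields.YangMills.BalabanUVNodes.N07AveragingLocalContinuity

end
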